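import Mathlib
import Summits.MatrixMultiplication.MatrixMultiplication.Theses.FidelityWitnesses
import Summits.MatrixMultiplication.MatrixMultiplication.Theorems.FidelityWitnessesFidelityThesisSepMajorantTransfer
import Summits.MatrixMultiplication.MatrixMultiplication.Theorems.FidelityThesis.Negative.SummitEquivalence
import Literature.Computability.AlgebraicComplexity.BigCwFourthOmega

/-!
# Line `Sketch` (separable-majorant) for crux `FidelityWitnesses.FidelityThesis` (stmt-MatrixMultiplication-4956) —
stub `stub_fidelityGrowthWindow`: the EXPONENT WINDOW of n-free fidelity growth

FIDELITY GROWTH at `(δ′, C)` is the line's open node: `M(n,r) ≤ C·r^{3/2−δ′}` for all `n, r`, i.e.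
`|⟨S,⟨n,n,n⟩⟩|² ≤ C r^{3/2−δ′}‖S‖²` whenever `tensorRank S ≤ r` (skeleton `Cruxes/FidelityThesis/Lines/Sketch.lean`,
`stub_fidelityGrowth`).  This file prices it against the exponent of matrix multiplication:

* `stub_fidelityGrowthWindow`: FG at `(δ′, C)` ⟹ `2 + 4δ′/(3−2δ′) ≤ ω(ℂ)` — the landed transfer
  `fidelityThesis_curve_of_fidelityGrowthAt` (FG ⇒ gaps along `r ≤ c·n^{2+δ}`, `δ = 4δ′/(3−2δ′)`,
  `c = (1/(2C))^{1/(3/2−δ′)}`) composed with the landed `fidelityThesis_le_omega_of_curve`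
  (`Theorems/FidelityThesis/Negative/SummitEquivalence`: gaps along such a curve force `2 + δ ≤ ω(ℂ)`).
* `not_fidelityGrowthAt_of_ge`: hence NO fidelity growth at any `δ′ ≥ 0.2358`, whatever `C` (tree bound
  `ω(ℂ) ≤ 2.37295`, `LeGall2014_cw4_omega_le`): `4δ′/(3−2δ′) ≤ 0.37295` forces `δ′ ≤ 0.23576`.
* `robustnessGrowthWindow`, `not_robustnessGrowthAt_of_ge`: the same two statements for ROBUSTNESS GROWTH (lead -0's
  stub shape; RG ⇒ FG is the landed `fidelityGrowthAt_of_robustnessGrowthAt`).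

So the admissible window of the open stub is `0 < δ′ < 0.2358` (and `δ′ ≤ 3/2 − 3/ω(ℂ)` exactly), matching the crux's
window `0 < δ ≤ ω(ℂ) − 2` (`Disproof.lean` §2b) under `δ = 4δ′/(3−2δ′)`.
Supports item `stmt-MatrixMultiplication-4956`; no definitions.
-/

namespace Summit.MatrixMultiplication.MatrixMultiplication.Theorems

open scoped BigOperators ComplexConjugate
open Literature.Computability.AlgebraicComplexity

/-- **Fidelity growth window.** n-free fidelity growth at `(δ′, C)` with `δ′ < 3/2`, `C > 0` —
`|⟨S,⟨n,n,n⟩⟩|² ≤ C·r^{3/2−δ′}·‖S‖²` for all `n, r` and all `S` of rank `≤ r` — forces `2 + 4δ′/(3−2δ′) ≤ ω(ℂ)`: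
FG gives the crux's gaps along the curve `r ≤ c·n^{2+δ}` with `δ = 4δ′/(3−2δ′)`, `c = (1/(2C))^{1/(3/2−δ′)} > 0`
(`fidelityThesis_curve_of_fidelityGrowthAt`), and gaps along such a curve force `2 + δ ≤ ω(ℂ)`
(`fidelityThesis_le_omega_of_curve`, via `S = ⟨n,n,n⟩` at `r = R(⟨n,n,n⟩)`). [folklore] -/
theorem stub_fidelityGrowthWindow {δ' C : ℝ} (hδ'1 : δ' < 3 / 2) (hC : 0 < C)
    (hFG : ∀ (n r : ℕ) (S : Fin n × Fin n → Fin n × Fin n → Fin n × Fin n → ℂ), tensorRank S ≤ r →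
      ‖∑ a, ∑ b, ∑ c, S a b c * matMulTensor ℂ n n n a b c‖ ^ 2 ≤
        C * (r : ℝ) ^ (3 / 2 - δ') * ∑ a, ∑ b, ∑ c, ‖S a b c‖ ^ 2) :
    2 + 4 * δ' / (3 - 2 * δ') ≤ omega ℂ :=
  fidelityThesis_le_omega_of_curve (by positivity) (fidelityThesis_curve_of_fidelityGrowthAt hδ'1 hC hFG)

/-- **No fidelity growth at any `δ′ ≥ 0.2358`** (whatever `C > 0`): by the window and the tree's `ω(ℂ) ≤ 2.37295`
(`LeGall2014_cw4_omega_le`), `4δ′/(3−2δ′) ≤ 0.37295`, i.e. `4.7459·δ′ ≤ 1.11885`, `δ′ ≤ 0.23576`. [folklore] -/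
theorem not_fidelityGrowthAt_of_ge {δ' C : ℝ} (hδ' : 0.2358 ≤ δ') (hδ'1 : δ' < 3 / 2) (hC : 0 < C) :
    ¬ ∀ (n r : ℕ) (S : Fin n × Fin n → Fin n × Fin n → Fin n × Fin n → ℂ), tensorRank S ≤ r →
      ‖∑ a, ∑ b, ∑ c, S a b c * matMulTensor ℂ n n n a b c‖ ^ 2 ≤
        C * (r : ℝ) ^ (3 / 2 - δ') * ∑ a, ∑ b, ∑ c, ‖S a b c‖ ^ 2 := by
  intro hFG
  have hω := stub_fidelityGrowthWindow hδ'1 hC hFG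
  have hLG := LeGall2014_cw4_omega_le ℂ
  have h32 : 0 < 3 - 2 * δ' := by linarith
  have hle : 4 * δ' / (3 - 2 * δ') ≤ 0.37295 := by linarith
  rw [div_le_iff₀ h32] at hle
  nlinarith

/-- **Robustness growth window.** Robustness growth at `(δ′, C)` — every span of `r` products `u_l ⊗ v_l ⊂ ℂ^{n×n} ⊗ ℂ^{n×n}`
admits a sub-normalised separable majorant of weight `≤ C·r^{3/2−δ′}` (lead -0's stub `stub_robustnessGrowth`, spelled out) —
forces `2 + 4δ′/(3−2δ′) ≤ ω(ℂ)`: RG ⇒ FG (`fidelityGrowthAt_of_robustnessGrowthAt`, the separable majorant law) ⇒ window.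
[folklore] -/
theorem robustnessGrowthWindow {δ' C : ℝ} (hδ'1 : δ' < 3 / 2) (hC : 0 < C)
    (hRG : ∀ (n r : ℕ) (u v : Fin r → Fin n × Fin n → ℂ),
      ∃ (m : ℕ) (p : Fin m → ℝ) (φ ψ : Fin m → Fin n × Fin n → ℂ) (lam : ℝ),
        0 ≤ lam ∧ lam ≤ C * (r : ℝ) ^ (3 / 2 - δ') ∧ (∀ k, 0 ≤ p k) ∧
        (∑ k, p k * ((∑ b, ‖φ k b‖ ^ 2) * ∑ c, ‖ψ k c‖ ^ 2) ≤ 1) ∧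
        ∀ (d : Fin r → ℂ) (z : Fin n × Fin n → Fin n × Fin n → ℂ),
          ‖∑ b, ∑ c, (∑ l, d l * u l b * v l c) * z b c‖ ^ 2 ≤
            lam * (∑ b, ∑ c, ‖∑ l, d l * u l b * v l c‖ ^ 2) *
              ∑ k, p k * ‖∑ b, ∑ c, φ k b * ψ k c * z b c‖ ^ 2) :
    2 + 4 * δ' / (3 - 2 * δ') ≤ omega ℂ :=
  stub_fidelityGrowthWindow hδ'1 hC (fidelityGrowthAt_of_robustnessGrowthAt hC hRG)

/-- **No robustness growth at any `δ′ ≥ 0.2358`** (whatever `C > 0`): RG ⇒ FG and `not_fidelityGrowthAt_of_ge`.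
[folklore] -/
theorem not_robustnessGrowthAt_of_ge {δ' C : ℝ} (hδ' : 0.2358 ≤ δ') (hδ'1 : δ' < 3 / 2) (hC : 0 < C) :
    ¬ ∀ (n r : ℕ) (u v : Fin r → Fin n × Fin n → ℂ),
      ∃ (m : ℕ) (p : Fin m → ℝ) (φ ψ : Fin m → Fin n × Fin n → ℂ) (lam : ℝ),
        0 ≤ lam ∧ lam ≤ C * (r : ℝ) ^ (3 / 2 - δ') ∧ (∀ k, 0 ≤ p k) ∧
        (∑ k, p k * ((∑ b, ‖φ k b‖ ^ 2) * ∑ c, ‖ψ k c‖ ^ 2) ≤ 1) ∧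
        ∀ (d : Fin r → ℂ) (z : Fin n × Fin n → Fin n × Fin n → ℂ),
          ‖∑ b, ∑ c, (∑ l, d l * u l b * v l c) * z b c‖ ^ 2 ≤
            lam * (∑ b, ∑ c, ‖∑ l, d l * u l b * v l c‖ ^ 2) *
              ∑ k, p k * ‖∑ b, ∑ c, φ k b * ψ k c * z b c‖ ^ 2 :=
  fun hRG => not_fidelityGrowthAt_of_ge hδ' hδ'1 hC (fidelityGrowthAt_of_robustnessGrowthAt hC hRG)

end Summit.MatrixMultiplication.MatrixMultiplication.Theorems
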